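import Summits.KontsevichZagierPeriods.KontsevichZagierPeriods.Theorems.RootDecompWalshStrataPiFourRung

/-!
# Root decomposition on Walsh strata — part 103 (gen 13): the `π`-isotypic Baker sector `[hq]·B`

Crux `QuadricSignKernel` (item 25393), slice `d = 4` (the weight-two wall).  Gen 12 split the
weight-two wall into SECTORS and proved Conjecture 1 in kernel form on the `π`-polynomial sector `Π`
(`PiSector.piKernel`, Lindemann) and on `Π^alg` (part 100), leaving the JOINT sector `B ∪ Π`
(`PiAt.JointKernel`) as the typed oracle for mixed families.  The critic (g6-7) asked that residuals be
stated PER EXPLICIT SECTOR.  This part opens the sector filtration of gen 13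

  `B ⊂ [hq]·B`, `Π ⊂ A := B + [hq]·B ⊂ D := B + B·B ⊂ R₂`

(`B` = span of the rational representations of dimension `≤ 1`, the Baker sector; `[hq] = [(0,1), dt/(1+t²)]`,
value `π/4`) and proves:

1. **Kernel transport** (`kernel_mulGens`): if Conjecture 1 in kernel form holds on the span of a set
   `S` of generators, it holds on the span of `[t]·S` for every representation `t` of NON-ZERO value —
   `eval ([t]·x) = value t · eval x` (`KZ.eval_mul'`, Fubini) forces `eval x = 0`, so `x ∈ relations`,
   so `[t]·x ∈ relations` (`KZ.of_mul_mem_relations`: relations are an ideal).  This is the EASY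
   direction of `π`-cancellation, and it is all the weight-two wall needs on the `π`-divisible side.
2. **The `π`-isotypic Baker sector** `piBGens = [hq,1]·bakerGens` (values `π·(ℚ + ℚπ + Σ ℚ̄ log ℚ̄)`,
   e.g. `π²`, `π log 2`, `π·arctan √2`): Conjecture 1 in kernel form HOLDS on it — `piBKernel`, a
   THEOREM (Baker + transport).  `InPiBaker x` («`x ≡ [hq,1]·y` modulo relations, `y ∈ B`») is closed
   under `+ / −`, contains every 4-ball cell, and `sum_mem_relations_of_inPiBaker` is the unconditional
   mechanism for `π`-isotypic families (parts 104–107 put the face-cut balls `(0,1)⁴ ∩ {Σxᵢ² < ρ}`,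
   `0 < ρ ≤ 2`, there: the first `d = 4` cells whose values `π·arctan √(ρ−1) + …` leave `ℚ + ℚπ + ℚπ²`;
   for `2 < ρ ≤ 3` the same caps-and-charts mechanism applies (pairwise cap overlaps are again
   planar-base × quarter-disc products — not typed here); for `3 < ρ < 4` the triple cap overlaps are
   4-ball sectors cut by three hyperplanes, whose volumes carry genuinely weight-two terms (products
   `arcsin a · arccos b` of algebraic arguments and a dilogarithmic Schläfli-type integral — the motive
   of (quadric, hyperplanes) is mixed Tate), so those cells are EXPECTED to leave `A` altogether).
3. **The affine-`π` sector** `affGens = bakerGens ∪ piBGens` with its ONE typed oracle `AffinePiKernel`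
   (`@[conjecture]`; implied by the summit: `affinePiKernel_of_summit`); `Π ⊆ A` on the nose
   (`piGens_subset_affGens`), `A ⊆ D` (`affGens_subset_decompGens`), hence
   `RationalTwoKernel → DecomposableTwoKernel → AffinePiKernel → JointKernel`; and the named sufficient
   transcendence input `PiNotBakerQuotient` («`β₀ + (π/4)·β₁ = 0` with `βᵢ` Baker periods forces
   `β₁ = 0`», Schanuel-class, NOT implied by the summit as typed) with
   `affinePiKernel_of_piNotBakerQuotient`.

[Baker1975 Thm 2.1; KontsevichZagier2001 §1.2, §4.1; this node (gen 13)]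
-/

noncomputable section

open Literature.NumberTheory.Transcendental
open MeasureTheory Set
open MvPolynomial (aeval X C)
open Summit.KontsevichZagierPeriods.RootDecompWalshStrata.WalshSpanProof (cellRep cellRep_domain
  cellRep_integrand)
open Summit.KontsevichZagierPeriods.RootDecompWalshStrata.QuadricFourRung (QuadricFour RationalTwoKernel
  rationalTwoKernel_of_summit)
open Summit.KontsevichZagierPeriods.RootDecompWalshStrata.Ball4 (ball4Poly)
open Summit.KontsevichZagierPeriods.RootDecompWalshStrata.DecompTwo (bakerGens decompGens
  DecomposableTwoKernel decomposableTwoKernel_of_rationalTwoKernel sum_mem_relations_of_descent)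
open Summit.KontsevichZagierPeriods.RootDecompWalshStrata.PiSector (cstRep hqRep hq2Rep piGens piKernel
  value_hqRep isRational_hqRep of_hqRep_mul_of_hqRep)
open Summit.KontsevichZagierPeriods.RootDecompWalshStrata.PiAt (QuadricDescentAt JointKernel descentAt_mono
  sum_mem_relations_of_descentAt quadricFour_of_descentAt descentAt_of_cellRep
  of_ball4_cell_sub_of_hq2Rep_mem_relations)
open Summit.KontsevichZagierPeriods.HurwitzMicroSectors.NormalFormPrinciple

namespace Summit.KontsevichZagierPeriods.RootDecompWalshStrata.PiB

/-! #### 1. Kernel transport along a factor of non-zero value -/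

/-- The translate `[t]·S = {t * y | y ∈ S}` of a set of generators. [definition] -/
def mulGens (t : KZ.FormalRep) (S : Set KZ.FormalRep) : Set KZ.FormalRep := (fun y => t * y) '' S

/-- Members of `[t]·S`. [definition] -/
theorem mul_mem_mulGens (t : KZ.FormalRep) {S : Set KZ.FormalRep} {y : KZ.FormalRep} (hy : y ∈ S) :
    t * y ∈ mulGens t S := ⟨y, hy, rfl⟩

/-- The span of `[t]·S` is the image of the span of `S` under left multiplication by `t`.
[folklore] -/
theorem closure_mulGens (t : KZ.FormalRep) (S : Set KZ.FormalRep) :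
    AddSubgroup.closure (mulGens t S) = (AddSubgroup.closure S).map (AddMonoidHom.mulLeft t) := by
  rw [AddMonoidHom.map_closure]
  rfl

/-- Left multiples of span elements lie in the span of the translate. [folklore] -/
theorem mul_mem_closure_mulGens (t : KZ.FormalRep) {S : Set KZ.FormalRep} {y : KZ.FormalRep}
    (hy : y ∈ AddSubgroup.closure S) : t * y ∈ AddSubgroup.closure (mulGens t S) := by
  rw [closure_mulGens]
  exact AddSubgroup.mem_map.mpr ⟨y, hy, rfl⟩

/-- Elements of the span of the translate are left multiples of span elements. [folklore] -/
theorem exists_eq_mul_of_mem_closure_mulGens (t : KZ.FormalRep) {S : Set KZ.FormalRep}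
    {x : KZ.FormalRep} (hx : x ∈ AddSubgroup.closure (mulGens t S)) :
    ∃ y ∈ AddSubgroup.closure S, x = t * y := by
  rw [closure_mulGens] at hx
  obtain ⟨y, hy, rfl⟩ := AddSubgroup.mem_map.mp hx
  exact ⟨y, hy, rfl⟩

/-- **KERNEL TRANSPORT.** If Conjecture 1 in kernel form holds on the span of `S`, it holds on the
span of `[t]·S` for every representation `t` of non-zero value: `eval ([t]·y) = value t · eval y`
(`KZ.eval_mul'`, Fubini), so `eval y = 0`, so `y ∈ relations` (hypothesis), so `[t]·y ∈ relations`
(`KZ.of_mul_mem_relations`, the ideal property).  The easy direction of `π`-cancellation.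
[KontsevichZagier2001 §1.2, §4.1; this node] -/
theorem kernel_mulGens {l : ℕ} (t : KZ.IntegralRep l) (ht : t.value ≠ 0) {S : Set KZ.FormalRep}
    (hK : ∀ ⦃x : KZ.FormalRep⦄, x ∈ AddSubgroup.closure S → KZ.eval x = 0 → x ∈ KZ.relations) :
    ∀ ⦃x : KZ.FormalRep⦄, x ∈ AddSubgroup.closure (mulGens (KZ.of t) S) → KZ.eval x = 0 →
      x ∈ KZ.relations := by
  intro x hx hv
  obtain ⟨y, hy, rfl⟩ := exists_eq_mul_of_mem_closure_mulGens (KZ.of t) hx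
  rw [KZ.eval_mul', KZ.eval_of] at hv
  have hy0 : KZ.eval y = 0 := by
    rcases mul_eq_zero.mp hv with h | h
    · exact absurd h ht
    · exact h
  exact KZ.of_mul_mem_relations t (hK hy hy0)

/-! #### 2. The Baker sector and its `π`-isotypic translate -/

/-- **Conjecture 1 in kernel form on the Baker sector** (the tree's theorem in dimension `≤ 1`,
`PiBox.Dlog.mem_relations_of_eval_eq_zero_of_dim_le_one`, restated on `bakerGens`).
[Baker1975 Thm 2.1; KontsevichZagier2001 §1.2] -/
theorem bakerKernel : ∀ ⦃x : KZ.FormalRep⦄, x ∈ AddSubgroup.closure bakerGens → KZ.eval x = 0 →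
    x ∈ KZ.relations :=
  fun _ hx hv => PiBox.Dlog.mem_relations_of_eval_eq_zero_of_dim_le_one hx hv

/-- `value [hq, 1] = π/4 ≠ 0`. [folklore] -/
theorem value_hqRep_one_ne_zero : (hqRep 1).value ≠ 0 := by
  rw [value_hqRep]
  have := Real.pi_pos
  positivity

/-- **The `π`-isotypic Baker generators** `[hq,1]·[N]`, `N` rational of dimension `≤ 1`
(values `(π/4)·(Baker periods)`: `π²`, `π log α`, `π arctan √ρ`, …). [this node] -/
def piBGens : Set KZ.FormalRep := mulGens (KZ.of (hqRep 1)) bakerGens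

/-- **Conjecture 1 in kernel form HOLDS on the `π`-isotypic Baker sector** — a THEOREM: Baker's
theorem transported along `[hq,1]` (value `π/4 ≠ 0`). [Baker1975 Thm 2.1; KontsevichZagier2001 §1.2, §4.1;
this node] -/
theorem piBKernel : ∀ ⦃x : KZ.FormalRep⦄, x ∈ AddSubgroup.closure piBGens → KZ.eval x = 0 →
    x ∈ KZ.relations :=
  kernel_mulGens (hqRep 1) value_hqRep_one_ne_zero bakerKernel

/-- A rational representation of dimension `≤ 1` is a Baker generator. [definition] -/
theorem of_mem_bakerGens {m : ℕ} (N : KZ.IntegralRep m) (hm : m ≤ 1) (hN : N.IsRational) :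
    KZ.of N ∈ bakerGens := ⟨m, N, hm, hN, rfl⟩

/-- `[hq, b]` is a Baker generator. [KontsevichZagier2001 §1.1] -/
theorem of_hqRep_mem_bakerGens (b : ℚ) : KZ.of (hqRep b) ∈ bakerGens :=
  of_mem_bakerGens (hqRep b) le_rfl (isRational_hqRep b)

/-- `[pt, a]` is a rational representation (of dimension `0`). [KontsevichZagier2001 §1.1] -/
theorem isRational_cstRep (a : ℚ) : (cstRep a).IsRational :=
  ⟨C a, 1, fun x _ => by simp, fun x _ => by simp⟩

/-- `[pt, a]` is a Baker generator. [KontsevichZagier2001 §1.1] -/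
theorem of_cstRep_mem_bakerGens (a : ℚ) : KZ.of (cstRep a) ∈ bakerGens :=
  of_mem_bakerGens (cstRep a) (Nat.zero_le 1) (isRational_cstRep a)

/-- `[hq,1]·[N]` is a `π`-isotypic generator. [definition] -/
theorem mul_of_mem_piBGens {m : ℕ} (N : KZ.IntegralRep m) (hm : m ≤ 1) (hN : N.IsRational) :
    KZ.of (hqRep 1) * KZ.of N ∈ piBGens :=
  mul_mem_mulGens _ (of_mem_bakerGens N hm hN)

/-- The square generator `[hq2Rep c] = [hq,1]·[hq,c]` of `Π` is a `π`-isotypic generator. [this node] -/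
theorem of_hq2Rep_mem_piBGens (c : ℚ) : KZ.of (hq2Rep c) ∈ piBGens := by
  rw [← of_hqRep_mul_of_hqRep]
  exact mul_of_mem_piBGens (hqRep c) le_rfl (isRational_hqRep c)

/-! #### 3. `InPiBaker`: congruent modulo relations to `[hq,1]·(Baker sector)` -/

/-- The set of `x` with `x ≡ [hq,1]·y` modulo `KZ.relations` for some `y` in the Baker sector (the
carrier of `[hq,1]·B ⊔ KZ.relations`); used applicatively, `InPiBaker x`. [this node] -/
def InPiBaker : Set KZ.FormalRep :=
  {x | ∃ y ∈ AddSubgroup.closure bakerGens, x - KZ.of (hqRep 1) * y ∈ KZ.relations}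

namespace InPiBaker

/-- A relation is `InPiBaker` (with `y = 0`). [this node] -/
theorem of_mem_relations {x : KZ.FormalRep} (hx : x ∈ KZ.relations) : InPiBaker x :=
  ⟨0, AddSubgroup.zero_mem _, by rwa [mul_zero, sub_zero]⟩

/-- `InPiBaker` is closed under addition. [this node] -/
theorem add {x x' : KZ.FormalRep} (hx : InPiBaker x) (hx' : InPiBaker x') : InPiBaker (x + x') := by
  obtain ⟨y, hy, hrel⟩ := hx
  obtain ⟨y', hy', hrel'⟩ := hx'
  refine ⟨y + y', AddSubgroup.add_mem _ hy hy', ?_⟩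
  have : x + x' - KZ.of (hqRep 1) * (y + y') =
      (x - KZ.of (hqRep 1) * y) + (x' - KZ.of (hqRep 1) * y') := by
    rw [mul_add]; abel
  rw [this]
  exact add_mem hrel hrel'

/-- `InPiBaker` is closed under negation. [this node] -/
theorem neg {x : KZ.FormalRep} (hx : InPiBaker x) : InPiBaker (-x) := by
  obtain ⟨y, hy, hrel⟩ := hx
  refine ⟨-y, AddSubgroup.neg_mem _ hy, ?_⟩
  have : -x - KZ.of (hqRep 1) * -y = -(x - KZ.of (hqRep 1) * y) := by
    rw [mul_neg]; abel
  rw [this]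
  exact neg_mem hrel

/-- `InPiBaker` is closed under subtraction. [this node] -/
theorem sub {x x' : KZ.FormalRep} (hx : InPiBaker x) (hx' : InPiBaker x') : InPiBaker (x - x') := by
  rw [sub_eq_add_neg]; exact hx.add hx'.neg

/-- `InPiBaker` is invariant under congruence modulo relations. [this node] -/
theorem congr {x x' : KZ.FormalRep} (hx : InPiBaker x) (h : x' - x ∈ KZ.relations) : InPiBaker x' := by
  obtain ⟨y, hy, hrel⟩ := hx
  refine ⟨y, hy, ?_⟩
  have : x' - KZ.of (hqRep 1) * y = (x' - x) + (x - KZ.of (hqRep 1) * y) := by abel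
  rw [this]
  exact add_mem h hrel

/-- `[hq,1]·[N]` is `InPiBaker` for `N` rational of dimension `≤ 1`. [this node] -/
theorem mul_of {m : ℕ} (N : KZ.IntegralRep m) (hm : m ≤ 1) (hN : N.IsRational) :
    InPiBaker (KZ.of (hqRep 1) * KZ.of N) :=
  ⟨KZ.of N, AddSubgroup.subset_closure (of_mem_bakerGens N hm hN), by
    rw [sub_self]; exact KZ.relations.zero_mem⟩

/-- **`[hq,1]·x` is `InPiBaker` whenever `x` is congruent to the Baker sector** (`x − y ∈ relations`,
`y ∈ B`): the ideal property `[hq,1]·(x − y) ∈ relations`. [KontsevichZagier2001 §4.1; this node] -/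
theorem mul_of_sub_mem {x y : KZ.FormalRep} (hy : y ∈ AddSubgroup.closure bakerGens)
    (h : x - y ∈ KZ.relations) : InPiBaker (KZ.of (hqRep 1) * x) :=
  ⟨y, hy, by rw [← mul_sub]; exact KZ.of_mul_mem_relations (hqRep 1) h⟩

/-- **Right products**: `x·[hq,1]` is `InPiBaker` whenever `x` is congruent to the Baker sector
(commutativity modulo relations, `KZ.mul_sub_mul_comm_mem_relations`). [KontsevichZagier2001 §4.1; this node] -/
theorem of_mul_sub_mem {x y : KZ.FormalRep} (hy : y ∈ AddSubgroup.closure bakerGens)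
    (h : x - y ∈ KZ.relations) : InPiBaker (x * KZ.of (hqRep 1)) :=
  (mul_of_sub_mem hy h).congr (KZ.mul_sub_mul_comm_mem_relations x (KZ.of (hqRep 1)))

/-- `[hq2Rep c]` is `InPiBaker`. [this node] -/
theorem of_hq2Rep (c : ℚ) : InPiBaker (KZ.of (hq2Rep c)) := by
  rw [← of_hqRep_mul_of_hqRep]
  exact mul_of (hqRep c) le_rfl (isRational_hqRep c)

/-- **The 4-ball cell `[(0,1)⁴ ∩ {Σxᵢ² < 1}, q]` is `InPiBaker`** (`≡ [hq2Rep (q/2)]`, part 95).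
[KontsevichZagier2001 §1.2, §4.1; this node] -/
theorem of_ball4_cell (q : ℚ) : InPiBaker (KZ.of (cellRep ball4Poly q)) :=
  (of_hq2Rep (q / 2)).congr (of_ball4_cell_sub_of_hq2Rep_mem_relations q)

/-- An `InPiBaker` element descends into the span of `piBGens`. [this node] -/
theorem exists_descent {x : KZ.FormalRep} (hx : InPiBaker x) :
    ∃ y ∈ AddSubgroup.closure piBGens, x - y ∈ KZ.relations := by
  obtain ⟨y, hy, hrel⟩ := hx
  exact ⟨KZ.of (hqRep 1) * y, mul_mem_closure_mulGens _ hy, hrel⟩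

end InPiBaker

/-- **THE UNCONDITIONAL MECHANISM on the `π`-isotypic sector.** Every vanishing `ℤ`-combination of
representations each of which is `InPiBaker` is a Kontsevich–Zagier relation (descend; `piBKernel`).
[Baker1975 Thm 2.1; KontsevichZagier2001 §1.2, §4.1; this node] -/
theorem sum_mem_relations_of_inPiBaker (k : ℕ) (d : Fin k → ℕ) (ρ : (i : Fin k) → KZ.IntegralRep (d i))
    (c : Fin k → ℤ) (h : ∀ i, InPiBaker (KZ.of (ρ i))) (hv : KZ.eval (∑ i, c i • KZ.of (ρ i)) = 0) :
    (∑ i, c i • KZ.of (ρ i)) ∈ KZ.relations := by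
  choose y hy hrel using fun i => (h i).exists_descent
  exact sum_mem_relations_of_descent piBKernel k d ρ c y hy hrel hv

/-- A quadric all of whose standard cells are `InPiBaker` is in the `[hq]·B`-class. [this node] -/
theorem piBDescentAt_of_inPiBaker {d : ℕ} {P : MvPolynomial (Fin d) ℚ}
    (h : ∀ q : ℚ, InPiBaker (KZ.of (cellRep P q))) : QuadricDescentAt piBGens P :=
  descentAt_of_cellRep fun _ q => (h q).exists_descent

/-- The 4-ball is in the `[hq]·B`-class. [KontsevichZagier2001 §1.2, §4.1; this node] -/
theorem piBDescentAt_ball4 : QuadricDescentAt piBGens ball4Poly :=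
  piBDescentAt_of_inPiBaker InPiBaker.of_ball4_cell

/-- **Conjecture 1 (kernel form) for the `[hq]·B`-class, UNCONDITIONALLY** (any dimensions, any
number of cells). [Baker1975 Thm 2.1; KontsevichZagier2001 §1.2, §4.1; this node] -/
theorem sum_mem_relations_piB (k : ℕ) (d : Fin k → ℕ) (P : (i : Fin k) → MvPolynomial (Fin (d i)) ℚ)
    (q : Fin k → ℚ) (ρ : (i : Fin k) → KZ.IntegralRep (d i)) (c : Fin k → ℤ)
    (hW : ∀ i, QuadricDescentAt piBGens (P i))
    (hρ : ∀ i, (ρ i).domain = {x | (∀ j, 0 < x j ∧ x j < 1) ∧ 0 < MvPolynomial.aeval x (P i)} ∧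
      ∀ x ∈ (ρ i).domain, (ρ i).integrand x = (q i : ℝ))
    (hdeg : ∀ i, (P i).totalDegree ≤ 2) (hv : KZ.eval (∑ i, c i • KZ.of (ρ i)) = 0) :
    (∑ i, c i • KZ.of (ρ i)) ∈ KZ.relations :=
  sum_mem_relations_of_descentAt piBKernel k d P q ρ c hW hρ hdeg hv

/-! #### 4. The affine-`π` sector `A = B + [hq]·B` and its one typed oracle -/

/-- **The affine-`π` generators**: Baker generators and their `[hq,1]`-translates
(values `ℚ + ℚπ + Σℚ̄ log ℚ̄ + π·(the same)`). [this node] -/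
def affGens : Set KZ.FormalRep := bakerGens ∪ piBGens

/-- **`AffinePiKernel`** — Conjecture 1 in kernel form on the affine-`π` sector `A = B + [hq]·B`:
the ONE oracle of the sector of balls, face-cut balls (`ρ ≤ 2`, part 107), ellipsoid orthants,
paraboloids, cones and weight-one cells mixed (NOT of the whole `d = 4` wall: cube-cut balls with
`3 < ρ < 4` are expected to carry dilogarithmic Schläfli volumes outside `A`).
Its transcendence content beyond Baker and `piBKernel` is the separation of `B` from `[hq]·B`
(«`π ∉ (B − 0)/(B − 0)`», Schanuel-class, open); it is implied by the summit
(`affinePiKernel_of_summit`). [Baker1975 Thm 2.1; KontsevichZagier2001 §1.2; this node] -/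
@[conjecture] def AffinePiKernel : Prop :=
  ∀ ⦃x : KZ.FormalRep⦄, x ∈ AddSubgroup.closure affGens → KZ.eval x = 0 → x ∈ KZ.relations

/-- `Π ⊆ A` on the nose: `[pt,a], [hq,b] ∈ B` and `[hq2Rep c] ∈ [hq]·B`. [this node] -/
theorem piGens_subset_affGens : piGens ⊆ affGens := by
  rintro y ((⟨a, rfl⟩ | ⟨b, rfl⟩) | ⟨c, rfl⟩)
  · exact Or.inl (of_cstRep_mem_bakerGens a)
  · exact Or.inl (of_hqRep_mem_bakerGens b)
  · exact Or.inr (of_hq2Rep_mem_piBGens c)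

/-- `B ⊆ A`. [definition] -/
theorem bakerGens_subset_affGens : bakerGens ⊆ affGens := subset_union_left

/-- `[hq]·B ⊆ A`. [definition] -/
theorem piBGens_subset_affGens : piBGens ⊆ affGens := subset_union_right

/-- `A ⊆ D`: a `π`-isotypic generator `[hq,1]·[N]` is a product of two Baker generators. [this node] -/
theorem affGens_subset_decompGens : affGens ⊆ decompGens := by
  rintro y (hy | ⟨z, ⟨m, N, hm, hN, rfl⟩, rfl⟩)
  · exact Or.inl hy
  · exact Or.inr ⟨1, m, hqRep 1, N, le_rfl, hm, isRational_hqRep 1, hN, rfl⟩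

/-- **`DecomposableTwoKernel → AffinePiKernel`** (`A ⊆ D`). [this node] -/
theorem affinePiKernel_of_decomposableTwoKernel (hD : DecomposableTwoKernel) : AffinePiKernel :=
  fun _ hx hv => hD (AddSubgroup.closure_mono affGens_subset_decompGens hx) hv

/-- **`RationalTwoKernel → AffinePiKernel`** (`A ⊆ D ⊆ R₂`). [this node] -/
theorem affinePiKernel_of_rationalTwoKernel (hK : RationalTwoKernel) : AffinePiKernel :=
  affinePiKernel_of_decomposableTwoKernel (decomposableTwoKernel_of_rationalTwoKernel hK)

/-- **The oracle is implied by the summit** (so the node stays on-path). [KontsevichZagier2001 §1.2] -/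
theorem affinePiKernel_of_summit (hS : _root_.KontsevichZagierPeriods) : AffinePiKernel :=
  affinePiKernel_of_rationalTwoKernel (rationalTwoKernel_of_summit hS)

/-- **`AffinePiKernel → JointKernel`** (`B ∪ Π ⊆ A`): the gen-12 oracle is a consequence of the
gen-13 one. [this node] -/
theorem jointKernel_of_affinePiKernel (hA : AffinePiKernel) : JointKernel :=
  fun _ hx hv => hA (AddSubgroup.closure_mono (union_subset bakerGens_subset_affGens
    piGens_subset_affGens) hx) hv

/-- The `Π`-class lies in the `A`-class. [definition] -/
theorem affDescentAt_of_piDescentAt {d : ℕ} {P : MvPolynomial (Fin d) ℚ}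
    (h : QuadricDescentAt piGens P) : QuadricDescentAt affGens P :=
  descentAt_mono piGens_subset_affGens h

/-- The `[hq]·B`-class lies in the `A`-class. [definition] -/
theorem affDescentAt_of_piBDescentAt {d : ℕ} {P : MvPolynomial (Fin d) ℚ}
    (h : QuadricDescentAt piBGens P) : QuadricDescentAt affGens P :=
  descentAt_mono piBGens_subset_affGens h

/-- The Baker class lies in the `A`-class. [definition] -/
theorem affDescentAt_of_bakerDescentAt {d : ℕ} {P : MvPolynomial (Fin d) ℚ}
    (h : QuadricDescentAt bakerGens P) : QuadricDescentAt affGens P :=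
  descentAt_mono bakerGens_subset_affGens h

/-- **The node on the affine-`π` sector: `QuadricFour ⟸ AffinePiKernel ∧` (every quadric of
dimension `≤ 4` is in the `A`-class).** [KontsevichZagier2001 §1.2; this node] -/
theorem quadricFour_of_affinePiKernel (hA : AffinePiKernel)
    (h : ∀ d, d ≤ 4 → ∀ P : MvPolynomial (Fin d) ℚ, QuadricDescentAt affGens P) : QuadricFour :=
  quadricFour_of_descentAt hA h

/-- **Conjecture 1 (kernel form) for mixed families in the `A`-class, given `AffinePiKernel`.**
[KontsevichZagier2001 §1.2; this node] -/
theorem sum_mem_relations_aff (hA : AffinePiKernel) (k : ℕ) (d : Fin k → ℕ)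
    (P : (i : Fin k) → MvPolynomial (Fin (d i)) ℚ) (q : Fin k → ℚ)
    (ρ : (i : Fin k) → KZ.IntegralRep (d i)) (c : Fin k → ℤ) (hW : ∀ i, QuadricDescentAt affGens (P i))
    (hρ : ∀ i, (ρ i).domain = {x | (∀ j, 0 < x j ∧ x j < 1) ∧ 0 < MvPolynomial.aeval x (P i)} ∧
      ∀ x ∈ (ρ i).domain, (ρ i).integrand x = (q i : ℝ))
    (hdeg : ∀ i, (P i).totalDegree ≤ 2) (hv : KZ.eval (∑ i, c i • KZ.of (ρ i)) = 0) :
    (∑ i, c i • KZ.of (ρ i)) ∈ KZ.relations :=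
  sum_mem_relations_of_descentAt hA k d P q ρ c hW hρ hdeg hv

/-! #### 5. The transcendence content of the oracle, named -/

/-- **`PiNotBakerQuotient`** — «`π/4` is not minus a quotient of two Baker periods»: if
`β₀ + (π/4)·β₁ = 0` with `β₀, β₁` values of elements of the Baker sector then `β₁ = 0` (hence `β₀ = 0`).
A consequence of Schanuel's conjecture (it needs `π² ∉ ℚ̄ + ℚ̄π + Σℚ̄ log αᵢ + Σℚ̄ π log αᵢ`); OPEN;
SUFFICIENT for `AffinePiKernel`, not implied by the summit as typed. [Baker1975 Thm 2.1; this node] -/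
@[conjecture] def PiNotBakerQuotient : Prop :=
  ∀ ⦃x₀ x₁ : KZ.FormalRep⦄, x₀ ∈ AddSubgroup.closure bakerGens → x₁ ∈ AddSubgroup.closure bakerGens →
    KZ.eval x₀ + Real.pi / 4 * KZ.eval x₁ = 0 → KZ.eval x₁ = 0

/-- Elements of the span of `A` split as `x₀ + [hq,1]·x₁` with `x₀, x₁` in the Baker sector. [folklore] -/
theorem exists_split_of_mem_closure_affGens {x : KZ.FormalRep} (hx : x ∈ AddSubgroup.closure affGens) :
    ∃ x₀ ∈ AddSubgroup.closure bakerGens, ∃ x₁ ∈ AddSubgroup.closure bakerGens,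
      x = x₀ + KZ.of (hqRep 1) * x₁ := by
  rw [affGens, AddSubgroup.closure_union] at hx
  obtain ⟨x₀, hx₀, z, hz, rfl⟩ := AddSubgroup.mem_sup.mp hx
  obtain ⟨x₁, hx₁, rfl⟩ := exists_eq_mul_of_mem_closure_mulGens (KZ.of (hqRep 1)) hz
  exact ⟨x₀, hx₀, x₁, hx₁, rfl⟩

/-- **`PiNotBakerQuotient → AffinePiKernel`.** Split `x = x₀ + [hq,1]·x₁`; the value is
`β₀ + (π/4)·β₁ = 0`, so `β₁ = 0` (hypothesis), so `[hq,1]·x₁ ∈ relations` (`piBKernel`) and `β₀ = 0`,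
so `x₀ ∈ relations` (Baker). [Baker1975 Thm 2.1; KontsevichZagier2001 §1.2, §4.1; this node] -/
theorem affinePiKernel_of_piNotBakerQuotient (h : PiNotBakerQuotient) : AffinePiKernel := by
  intro x hx hv
  obtain ⟨x₀, hx₀, x₁, hx₁, rfl⟩ := exists_split_of_mem_closure_affGens hx
  have hv' : KZ.eval x₀ + Real.pi / 4 * KZ.eval x₁ = 0 := by
    rw [map_add, KZ.eval_mul', KZ.eval_of, value_hqRep] at hv
    push_cast at hv
    linarith
  have h1 : KZ.eval x₁ = 0 := h hx₀ hx₁ hv'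
  have h0 : KZ.eval x₀ = 0 := by rw [h1, mul_zero, add_zero] at hv'; exact hv'
  exact add_mem (bakerKernel hx₀ h0)
    (piBKernel (mul_mem_closure_mulGens _ hx₁) (by rw [KZ.eval_mul', h1, mul_zero]))

end Summit.KontsevichZagierPeriods.RootDecompWalshStrata.PiB

end
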